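import Summits.ABC.ABC.Theorems.TwistAmplificationSharpModerateLawTwistMinimalDefs
import Literature.NumberTheory.EllipticCurves.SzpiroBGEquivalenceProofs

/-!
# Crux `TwistAmplification.SharpModerateLaw` (stmt-ABC-1975): strong Hall ⟹ pointwise Szpiro in cusp coordinates

Lead `prover-line-stmt-ABC-1975-c6-0`, skeleton v5 (line `unit-plane-conic-two-torsion`, twist-orbit inversion of the
core), helper `pointwiseSzpiroCusp_of_strongHall` of the calibration `pointwiseSzpiroCusp_iff_abc` of the residual stub
`stub_pointwiseSzpiro` (sibling file `…TwistMinimalPointwise.lean`).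

`pointwiseSzpiroCusp_of_strongHall : StrongHallConjecture → PointwiseSzpiroCusp` is Bombieri–Gubler, *Heights in
Diophantine Geometry* (2006), Theorem 12.5.12, the printed proof of (b) ⟹ (c) (pp. 432–433; tree template
`Literature.NumberTheory.EllipticCurves.generalizedSzpiroBG_of_strongHall`, whose arithmetic helpers are reused), run on
a tower-free cusp pair `(c₄, c₆)` in place of a global minimal model: with `1728 Δ = c₄³ − c₆²` and
`Γ = GCD (c₄³, c₆²) = Γ' g⁶` (`Γ'` sixth-power free), strong Hall bounds the primitive solution `(c₄/g², c₆/g³, 1728Δ/g⁶)`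
of `X³ − Y² = Z`; the three clauses of `TF` are literally the three uses of minimality (Corollary 12.5.7) and give
`g ∣ 72 · rad g`; and the conductor step becomes `rad g · rad Δ ∣ 36 · N5cusp`, because a prime `p ≥ 5` of `Δ` is
charged `p` in the proxy `N5cusp`, and `p²` when it also divides `c₄` — which every prime `p ≥ 5` of `g` does
(`charge_dvd_n5cusp`). No elliptic curve is needed. Constant: `2 · 72⁶ · C(η/3)³ · 62208^{6+η}`.
-/

noncomputable section

-- the mandated summit namespace `Summit.ABC.ABC` (summit = problem) trips the duplicate-namespace linter
set_option linter.dupNamespace false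

namespace Summit.ABC.ABC.Theorems.SharpModerateLaw

open UniqueFactorizationMonoid (radical radical_ne_zero radical_dvd_radical radical_mul_dvd)
open Literature.NumberTheory.DiophantineGeometry (IsPrimitiveHallSolution factorization_radical_apply)
open Literature.NumberTheory.EllipticCurves (exists_factorization_eq_div_six pow_natCast_dvd_of_factorization_le)
open Literature.NumberTheory.EllipticCurves (not_dvd_two_pow_mul_three_pow factorization_gcd_le_of_not_pow_dvd)
open Literature.NumberTheory.EllipticCurves (dvd_mul_radical_of_factorization_le)

/-! ## 1. Strong Hall ⟹ pointwise Szpiro in cusp coordinates (B–G 12.5.12 (b) ⟹ (c) with the proxy `N5cusp`) -/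

/-- The conductor proxy is a product of primes and squares of primes, hence nonzero. -/
theorem n5cusp_ne_zero (x : ℤ × ℤ) : N5cusp x ≠ 0 := by
  unfold N5cusp
  rw [Finset.prod_ne_zero_iff]
  intro p hp
  have hp' : p.Prime := Nat.prime_of_mem_primeFactors (Finset.mem_filter.mp hp).1
  split_ifs
  · exact pow_ne_zero _ hp'.ne_zero
  · exact hp'.ne_zero

/-- The local charge of the proxy: a prime `p ≥ 5` dividing `Δ' = (c₄³ − c₆²)/1728 ≠ 0` contributes its factor
(`p²` if `p ∣ c₄`, else `p`) to `N5cusp (c₄, c₆)`. -/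
theorem charge_dvd_n5cusp {x : ℤ × ℤ} {p : ℕ} (hp : p.Prime) (h5 : 5 ≤ p)
    (h0 : (x.1 ^ 3 - x.2 ^ 2) / 1728 ≠ 0) (hdvd : p ∣ ((x.1 ^ 3 - x.2 ^ 2) / 1728).natAbs) :
    (if ((p : ℕ) : ℤ) ∣ x.1 then p ^ 2 else p) ∣ N5cusp x := by
  unfold N5cusp
  exact Finset.dvd_prod_of_mem (fun q : ℕ => if ((q : ℕ) : ℤ) ∣ x.1 then q ^ 2 else q)
    (Finset.mem_filter.mpr ⟨Nat.mem_primeFactors.mpr ⟨hp, hdvd, Int.natAbs_ne_zero.mpr h0⟩, h5⟩)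

/-- **Strong Hall ⟹ `PointwiseSzpiroCusp`** (Bombieri–Gubler (2006), Theorem 12.5.12, the printed proof of
(b) ⟹ (c), pp. 432–433, run on tower-free cusp pairs instead of minimal models). For `x = (c₄, c₆)` tower-free with
`c₄c₆ ≠ 0`, `c₄³ ≠ c₆²`, `1728 ∣ c₄³ − c₆²`: put `1728 Δ = c₄³ − c₆²`, `Γ = GCD (c₄³, c₆²) = Γ' g⁶` with `Γ'`
sixth-power free; strong Hall at `η/3` for the primitive solution `(c₄/g², c₆/g³, 1728Δ/g⁶)` gives
`|c₄|³, |c₆|² ≤ C³ g⁶ rad(1728Δ)^{6+η}`; the three clauses of `TF` give `v₂(g) ≤ 3`, `v₃(g) ≤ 2`, `v_p(g) ≤ 1`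
(`p ≥ 5`), i.e. `g ∣ 72 · rad g`; `rad g · rad Δ ∣ 36 · N5cusp x` (a prime `p ≥ 5` of `g` divides `c₄` and `c₆`,
hence `Δ`, and is charged `p²` in `N5cusp`); finally `|Δ| ≤ (|c₄|³ + |c₆|²)/1728` and `M⁺ = max (|Δ|, |c₄|³)`. -/
theorem pointwiseSzpiroCusp_of_strongHall : Literature.NumberTheory.DiophantineGeometry.StrongHallConjecture → PointwiseSzpiroCusp := by
  intro hH η hη
  obtain ⟨C₀, hC₀⟩ := hH (η / 3) (by positivity)
  set C : ℝ := max C₀ 1 with hCdef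
  have hC1 : 1 ≤ C := le_max_right _ _
  have hC0 : 0 < C := one_pos.trans_le hC1
  set e : ℝ := 6 + η with hedef
  have he0 : 0 ≤ e := by positivity
  set K : ℝ := 72 ^ 6 * C ^ 3 * (1728 * 36) ^ e with hKdef
  have hK0 : 0 ≤ K := by positivity
  refine ⟨2 * K, fun x hx1 hx2 hne h1728 hTF ↦ ?_⟩
  -- `1728 Δ = c₄³ − c₆²`, `Δ = (c₄³ − c₆²)/1728 ≠ 0`
  obtain ⟨Δ, hΔ⟩ := h1728
  have hdiv : (x.1 ^ 3 - x.2 ^ 2) / 1728 = Δ := by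
    rw [hΔ]; exact Int.mul_ediv_cancel_left _ (by norm_num)
  have hΔ0 : Δ ≠ 0 := by
    intro h
    apply hne
    rw [← sub_eq_zero, hΔ, h, mul_zero]
  have hrel : 1728 * Δ = x.1 ^ 3 - x.2 ^ 2 := hΔ.symm
  -- `Γ = GCD (c₄³, c₆²) = Γ' g⁶`
  set Γ : ℕ := Int.gcd (x.1 ^ 3) (x.2 ^ 2) with hΓdef
  have hΓ0 : Γ ≠ 0 := by
    intro h
    rw [hΓdef, Int.gcd_eq_zero_iff] at h
    apply hΔ0
    have : (1728 : ℤ) * Δ = 0 := by rw [hrel, h.1, h.2, sub_zero]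
    simpa using this
  obtain ⟨g, hg0, hgfac⟩ := exists_factorization_eq_div_six Γ
  have hΓc₄ : (Γ : ℤ) ∣ x.1 ^ 3 := Int.gcd_dvd_left _ _
  have hΓc₆ : (Γ : ℤ) ∣ x.2 ^ 2 := Int.gcd_dvd_right _ _
  -- `g² ∣ c₄`, `g³ ∣ c₆`
  have hfacΓ : ∀ {c : ℤ} {n : ℕ}, c ≠ 0 → (Γ : ℤ) ∣ c ^ n → ∀ p : ℕ, p.Prime →
      Γ.factorization p ≤ n * c.natAbs.factorization p := by
    intro c n hc hdvd p hp
    have hcn : c.natAbs ≠ 0 := Int.natAbs_ne_zero.mpr hc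
    have hdvd' : Γ ∣ c.natAbs ^ n := by
      rw [← Int.natAbs_pow]; exact Int.natCast_dvd.mp hdvd
    have hle := Nat.factorization_le_factorization_of_dvd_right hdvd' hΓ0
      (pow_ne_zero _ hcn) (a := p)
    rw [Nat.factorization_pow] at hle
    simpa using hle
  have hg2 : (g : ℤ) ^ 2 ∣ x.1 := by
    refine pow_natCast_dvd_of_factorization_le hg0 hx1 fun p hp ↦ ?_
    have := hfacΓ hx1 hΓc₄ p hp
    rw [hgfac]; omega
  have hg3 : (g : ℤ) ^ 3 ∣ x.2 := by
    refine pow_natCast_dvd_of_factorization_le hg0 hx2 fun p hp ↦ ?_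
    have := hfacΓ hx2 hΓc₆ p hp
    rw [hgfac]; omega
  obtain ⟨u, hu⟩ := hg2
  obtain ⟨v, hv⟩ := hg3
  set z : ℤ := u ^ 3 - v ^ 2 with hzdef
  have hg0' : (g : ℤ) ≠ 0 := by exact_mod_cast hg0
  have hgz : (g : ℤ) ^ 6 * z = 1728 * Δ := by rw [hrel, hu, hv, hzdef]; ring
  have hz0 : z ≠ 0 := by
    intro h
    rw [h, mul_zero] at hgz
    exact hΔ0 (by simpa using hgz.symm)
  -- primitivity of `(u, v, z)`
  have hΓ' : Γ = g ^ 6 * Int.gcd (u ^ 3) (v ^ 2) := by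
    rw [hΓdef, hu, hv, mul_pow, mul_pow, ← pow_mul, ← pow_mul, Int.gcd_mul_left,
      Int.natAbs_pow, Int.natAbs_natCast]
  have hprim : IsPrimitiveHallSolution u v z := by
    refine ⟨rfl, hz0, fun d hd ↦ ?_⟩
    set Γ₁ := Int.gcd (u ^ 3) (v ^ 2) with hΓ₁
    have hΓ₁0 : Γ₁ ≠ 0 := by
      intro h; exact hΓ0 (by rw [hΓ', h, mul_zero])
    by_contra hd1
    have hd0 : d ≠ 0 := by
      rintro rfl
      exact hΓ₁0 (Nat.eq_zero_of_zero_dvd (by simpa using hd))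
    obtain ⟨q, hq, hqd⟩ := Nat.exists_prime_and_dvd hd1
    have hq6 : q ^ 6 ∣ Γ₁ := dvd_trans (pow_dvd_pow_of_dvd hqd 6) hd
    have h6 : 6 ≤ Γ₁.factorization q := (hq.pow_dvd_iff_le_factorization hΓ₁0).mp hq6
    have hfac : Γ.factorization q = 6 * g.factorization q + Γ₁.factorization q := by
      rw [hΓ', Nat.factorization_mul (pow_ne_zero _ hg0) hΓ₁0, Nat.factorization_pow]
      simp
    have := hgfac q
    omega
  -- the strong Hall conjecture for `(u, v, z)`
  obtain ⟨hHx, hHy⟩ := hC₀ u v z hprim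
  set Rz : ℝ := ((radical z.natAbs : ℕ) : ℝ) with hRz
  have hRz0 : 0 ≤ Rz := by positivity
  have hHx' : |(u : ℝ)| ≤ C * Rz ^ (2 + η / 3) :=
    hHx.trans (mul_le_mul_of_nonneg_right (le_max_left _ _) (by positivity))
  have hHy' : |(v : ℝ)| ≤ C * Rz ^ (3 + η / 3) :=
    hHy.trans (mul_le_mul_of_nonneg_right (le_max_left _ _) (by positivity))
  -- the radicals: `rad (z) ≤ 1728 rad (Δ)`, `g ≤ 72 rad (g)`, `rad (g) rad (Δ) ≤ 36 N5cusp`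
  set N : ℕ := N5cusp x with hNdef
  have hN0 : N ≠ 0 := n5cusp_ne_zero x
  have hΔn : Δ.natAbs ≠ 0 := Int.natAbs_ne_zero.mpr hΔ0
  have hradz : radical z.natAbs ≤ 1728 * radical Δ.natAbs := by
    have hz' : z.natAbs ∣ 1728 * Δ.natAbs := by
      have : z ∣ 1728 * Δ := ⟨(g : ℤ) ^ 6, by rw [← hgz]; ring⟩
      simpa [Int.natAbs_mul] using Int.natAbs_dvd_natAbs.mpr this
    have h1 : radical z.natAbs ∣ radical 1728 * radical Δ.natAbs :=
      (radical_dvd_radical hz' (mul_ne_zero (by norm_num) hΔn)).trans radical_mul_dvd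
    refine (Nat.le_of_dvd (by positivity) h1).trans ?_
    exact Nat.mul_le_mul_right _ (Nat.radical_le_self_iff.mpr (by norm_num))
  -- tower-freeness (the three uses of Corollary 12.5.7) ⟹ `v₂(g) ≤ 3`, `v₃(g) ≤ 2`, `v_p(g) ≤ 1`
  have hgle : ∀ p : ℕ, p.Prime → g.factorization p ≤ if p = 2 then 3 else if p = 3 then 2 else 1 := by
    intro p hp
    have cor : ∀ {e₄ e₆ : ℕ}, ¬ ((p : ℤ) ^ (e₄ + 4) ∣ x.1 ∧ (p : ℤ) ^ (e₆ + 6) ∣ x.2) →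
        Γ.factorization p ≤ max (3 * e₄ + 9) (2 * e₆ + 10) :=
      fun h ↦ factorization_gcd_le_of_not_pow_dvd (c₄ := x.1) (c₆ := x.2) hp (not_and_or.mp h)
    obtain ⟨hTF5, hTF2, hTF3⟩ := hTF
    rw [hgfac]
    by_cases h2 : p = 2
    · subst h2
      have := cor (e₄ := 4) (e₆ := 5) (by simpa using hTF2)
      rw [if_pos rfl]; omega
    by_cases h3 : p = 3
    · subst h3
      have := cor (e₄ := 1) (e₆ := 3) (by simpa using hTF3)
      rw [if_neg h2, if_pos rfl]; omega
    · have h5 : 5 ≤ p := by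
        have := hp.two_le
        by_contra h; interval_cases p <;> first | exact absurd hp (by decide) | omega
      have := cor (e₄ := 0) (e₆ := 0) (by simpa using hTF5 p hp h5)
      rw [if_neg h2, if_neg h3]; omega
  have hg72 : g ≤ 72 * radical g :=
    Nat.le_of_dvd (by positivity) (dvd_mul_radical_of_factorization_le hg0 hgle)
  -- `rad (g) rad (Δ) ∣ 36 N5cusp`: a prime `p ≥ 5` of `Δ` is charged `p`, and `p²` if it divides `c₄`
  have hchg : ∀ {p : ℕ}, p.Prime → 5 ≤ p → p ∣ Δ.natAbs →
      (if ((p : ℕ) : ℤ) ∣ x.1 then p ^ 2 else p) ∣ N := by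
    intro p hp h5 hdvd
    have h0 : (x.1 ^ 3 - x.2 ^ 2) / 1728 ≠ 0 := by rw [hdiv]; exact hΔ0
    exact charge_dvd_n5cusp hp h5 h0 (by rw [hdiv]; exact hdvd)
  have hradN : radical g * radical Δ.natAbs ∣ 36 * N := by
    have hrg : radical g ≠ 0 := radical_ne_zero
    have hrΔ : radical Δ.natAbs ≠ 0 := radical_ne_zero
    rw [← Nat.factorization_le_iff_dvd (mul_ne_zero hrg hrΔ) (mul_ne_zero (by norm_num) hN0)]
    intro p
    by_cases hp : p.Prime
    swap
    · simp [Nat.factorization_eq_zero_of_not_prime _ hp]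
    rw [Nat.factorization_mul hrg hrΔ, Nat.factorization_mul (by norm_num) hN0, Finsupp.add_apply,
      Finsupp.add_apply, factorization_radical_apply hg0 hp, factorization_radical_apply hΔn hp]
    by_cases h23 : p = 2 ∨ p = 3
    · -- at `2` and `3` the factor `36` absorbs both radicals
      have h36 : 2 ≤ (36 : ℕ).factorization p := by
        rw [show (36 : ℕ) = 6 ^ 2 by norm_num, Nat.factorization_pow, Finsupp.smul_apply, smul_eq_mul]
        have h6 : 1 ≤ (6 : ℕ).factorization p := by
          rcases h23 with rfl | rfl
          · exact (Nat.prime_two.dvd_iff_one_le_factorization (by norm_num)).mp (by norm_num)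
          · exact (Nat.prime_three.dvd_iff_one_le_factorization (by norm_num)).mp (by norm_num)
        omega
      split_ifs <;> omega
    · push Not at h23
      have h5 : 5 ≤ p := by
        have := hp.two_le
        by_contra h; interval_cases p <;> first | exact absurd hp (by decide) | omega
      have h36 : (36 : ℕ).factorization p = 0 := by
        apply Nat.factorization_eq_zero_of_not_dvd
        simpa using not_dvd_two_pow_mul_three_pow hp h5 2 2
      rw [h36, zero_add]
      have hpint : Prime (p : ℤ) := Nat.prime_iff_prime_int.mp hp
      -- `p ∣ Δ ⟹ v_p (N5cusp) ≥ 1`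
      have hbad : p ∣ Δ.natAbs → 1 ≤ N.factorization p := by
        intro h
        refine (hp.dvd_iff_one_le_factorization hN0).mp ?_
        have := hchg hp h5 h
        split_ifs at this
        · exact (dvd_pow_self p two_ne_zero).trans this
        · exact this
      -- `p ∣ g ⟹ p ∣ c₄, p ∣ c₆ ⟹ p ∣ Δ`, and `p` is charged `p²`
      have hpg : p ∣ g → 2 ≤ N.factorization p := by
        intro hdvd
        have h1 : 1 ≤ g.factorization p := (hp.dvd_iff_one_le_factorization hg0).mp hdvd
        have hΓ6 : 6 ≤ Γ.factorization p := by have := hgfac p; omega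
        have hpΓ : (p : ℤ) ∣ Γ :=
          Int.natCast_dvd_natCast.mpr ((hp.dvd_iff_one_le_factorization hΓ0).mpr (by omega))
        have hpc₄ : (p : ℤ) ∣ x.1 := hpint.dvd_of_dvd_pow (hpΓ.trans hΓc₄)
        have hpc₆ : (p : ℤ) ∣ x.2 := hpint.dvd_of_dvd_pow (hpΓ.trans hΓc₆)
        have hpΔ : p ∣ Δ.natAbs := by
          have hp1728 : (p : ℤ) ∣ 1728 * Δ := by
            rw [hrel]; exact dvd_sub (dvd_pow hpc₄ three_ne_zero) (dvd_pow hpc₆ two_ne_zero)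
          rcases Int.Prime.dvd_mul hp hp1728 with h | h
          · exact absurd h (by simpa using not_dvd_two_pow_mul_three_pow hp h5 6 3)
          · exact h
        refine (hp.pow_dvd_iff_le_factorization hN0).mp ?_
        have := hchg hp h5 hpΔ
        rwa [if_pos hpc₄] at this
      split_ifs with hdg hdΔ hdΔ
      · have := hpg hdg; omega
      · have := hpg hdg; omega
      · exact hbad hdΔ
      · exact Nat.zero_le _
  -- real numbers
  set Rg : ℝ := ((radical g : ℕ) : ℝ) with hRg
  set RΔ : ℝ := ((radical Δ.natAbs : ℕ) : ℝ) with hRΔ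
  set N' : ℝ := ((N : ℕ) : ℝ) with hN'
  have hRg1 : 1 ≤ Rg := by rw [hRg]; exact_mod_cast Nat.radical_pos g
  have hRΔ1 : 1 ≤ RΔ := by rw [hRΔ]; exact_mod_cast Nat.radical_pos _
  have hRzle : Rz ≤ 1728 * RΔ := by rw [hRz, hRΔ]; exact_mod_cast hradz
  have hgle' : (g : ℝ) ≤ 72 * Rg := by rw [hRg]; exact_mod_cast hg72
  have hB : Rg * RΔ ≤ 36 * N' := by
    have h := Nat.le_of_dvd (by positivity) hradN
    rw [hRg, hRΔ, hN']
    exact_mod_cast h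
  have h6e : (6 : ℝ) ≤ e := by rw [hedef]; linarith
  have hg6 : (g : ℝ) ^ 6 ≤ 72 ^ 6 * Rg ^ e := by
    calc (g : ℝ) ^ 6 ≤ (72 * Rg) ^ 6 := pow_le_pow_left₀ (by positivity) hgle' 6
      _ = 72 ^ 6 * Rg ^ ((6 : ℕ) : ℝ) := by rw [mul_pow, Real.rpow_natCast]
      _ ≤ 72 ^ 6 * Rg ^ e :=
        mul_le_mul_of_nonneg_left (Real.rpow_le_rpow_of_exponent_le hRg1 (by exact_mod_cast h6e))
          (by positivity)
  -- the common estimate for `|c₄|³ = g⁶ |u|³` and `|c₆|² = g⁶ |v|²`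
  have hRz1 : 1 ≤ Rz := by rw [hRz]; exact_mod_cast Nat.radical_pos _
  have key : ∀ (w : ℝ) (k : ℕ) (s : ℝ), 0 ≤ w → w ≤ C * Rz ^ s → (k : ℝ) * s ≤ e → k ≤ 3 →
      (g : ℝ) ^ 6 * w ^ k ≤ K * N' ^ e := by
    intro w k s hw0 hw hks hk3
    have h1 : w ^ k ≤ C ^ 3 * (1728 * RΔ) ^ e := by
      calc w ^ k ≤ (C * Rz ^ s) ^ k := pow_le_pow_left₀ hw0 hw k
        _ = C ^ k * Rz ^ ((k : ℝ) * s) := by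
          rw [mul_pow, ← Real.rpow_natCast (Rz ^ s) k, ← Real.rpow_mul hRz0, mul_comm s]
        _ ≤ C ^ 3 * Rz ^ e :=
          mul_le_mul (pow_le_pow_right₀ hC1 hk3) (Real.rpow_le_rpow_of_exponent_le hRz1 hks)
            (by positivity) (by positivity)
        _ ≤ C ^ 3 * (1728 * RΔ) ^ e :=
          mul_le_mul_of_nonneg_left (Real.rpow_le_rpow hRz0 hRzle he0) (by positivity)
    calc (g : ℝ) ^ 6 * w ^ k ≤ (72 ^ 6 * Rg ^ e) * (C ^ 3 * (1728 * RΔ) ^ e) :=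
          mul_le_mul hg6 h1 (by positivity) (by positivity)
      _ = 72 ^ 6 * C ^ 3 * 1728 ^ e * (Rg * RΔ) ^ e := by
          rw [Real.mul_rpow (by norm_num) (by positivity), Real.mul_rpow (by positivity) (by positivity)]
          ring
      _ ≤ 72 ^ 6 * C ^ 3 * 1728 ^ e * (36 * N') ^ e :=
          mul_le_mul_of_nonneg_left (Real.rpow_le_rpow (by positivity) hB he0) (by positivity)
      _ = K * N' ^ e := by
          rw [hKdef, Real.mul_rpow (by norm_num) (by positivity),
            Real.mul_rpow (by norm_num) (by norm_num)]
          ring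
  have hc₄3 : |(x.1 : ℝ)| ^ 3 ≤ K * N' ^ e := by
    have h : |(x.1 : ℝ)| ^ 3 = (g : ℝ) ^ 6 * |(u : ℝ)| ^ 3 := by
      rw [hu]; push_cast
      rw [abs_mul, abs_of_nonneg (by positivity : (0 : ℝ) ≤ (g : ℝ) ^ 2)]; ring
    rw [h]
    exact key _ 3 _ (abs_nonneg _) hHx' (by rw [hedef]; push_cast; linarith) le_rfl
  have hc₆2 : |(x.2 : ℝ)| ^ 2 ≤ K * N' ^ e := by
    have h : |(x.2 : ℝ)| ^ 2 = (g : ℝ) ^ 6 * |(v : ℝ)| ^ 2 := by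
      rw [hv]; push_cast
      rw [abs_mul, abs_of_nonneg (by positivity : (0 : ℝ) ≤ (g : ℝ) ^ 3)]; ring
    rw [h]
    exact key _ 2 _ (abs_nonneg _) hHy' (by rw [hedef]; push_cast; linarith) (by norm_num)
  have hKN : 0 ≤ K * N' ^ e := by positivity
  have hΔle : |(Δ : ℝ)| ≤ 2 * K * N' ^ e := by
    have hrel' : (1728 : ℝ) * Δ = (x.1 : ℝ) ^ 3 - (x.2 : ℝ) ^ 2 := by exact_mod_cast hrel
    calc |(Δ : ℝ)| ≤ |(1728 : ℝ) * Δ| := by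
          rw [abs_mul]
          exact le_mul_of_one_le_left (abs_nonneg _) (by norm_num)
      _ = |(x.1 : ℝ) ^ 3 - (x.2 : ℝ) ^ 2| := by rw [hrel']
      _ ≤ |(x.1 : ℝ) ^ 3| + |(x.2 : ℝ) ^ 2| := abs_sub _ _
      _ = |(x.1 : ℝ)| ^ 3 + |(x.2 : ℝ)| ^ 2 := by rw [abs_pow, abs_pow]
      _ ≤ K * N' ^ e + K * N' ^ e := add_le_add hc₄3 hc₆2
      _ = 2 * K * N' ^ e := by ring
  -- conclusion: `M⁺ = max (|Δ|, |c₄|³)`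
  have hM : (Mcusp x : ℝ) = max |(Δ : ℝ)| (|(x.1 : ℝ)| ^ 3) := by
    unfold Mcusp
    rw [hdiv, Nat.cast_max, Nat.cast_pow, Nat.cast_natAbs, Nat.cast_natAbs, Int.cast_abs, Int.cast_abs]
  rw [hM]
  refine max_le hΔle (hc₄3.trans ?_)
  linarith

end Summit.ABC.ABC.Theorems.SharpModerateLaw

end
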